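import Summits.ResolutionOfSingularities.ResolutionOfSingularities.Theorems.FrobeniusLadderFInjectiveMacaulayficationFullLastCentreAxisOrder
import Summits.ResolutionOfSingularities.ResolutionOfSingularities.Theorems.FrobeniusLadderFInjectiveMacaulayficationFullLastCentreResidual
import Summits.ResolutionOfSingularities.ResolutionOfSingularities.Theorems.FrobeniusLadderFInjectiveMacaulayficationFullLastCentreBudget
import Summits.ResolutionOfSingularities.ResolutionOfSingularities.Theorems.FrobeniusLadderFInjectiveMacaulayficationFullLastCentreDefs2
import Summits.ResolutionOfSingularities.ResolutionOfSingularities.Theorems.FrobeniusLadderFInjectiveMacaulayficationFullLastCentrePointChain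
import Summits.ResolutionOfSingularities.ResolutionOfSingularities.Theorems.FrobeniusLadderFInjectiveMacaulayficationFullLastCentreSlack
import Summits.ResolutionOfSingularities.ResolutionOfSingularities.Theorems.FrobeniusLadderFInjectiveMacaulayficationFullLastCentreEquiChain
import Summits.ResolutionOfSingularities.ResolutionOfSingularities.Theorems.FrobeniusLadderFInjectiveMacaulayficationFullLastCentreBed178TopLocus
import Summits.ResolutionOfSingularities.ResolutionOfSingularities.Theorems.FrobeniusLadderFInjectiveMacaulayficationFullLastCentreTame
import Summits.ResolutionOfSingularities.ResolutionOfSingularities.Theorems.FrobeniusLadderFInjectiveMacaulayficationFullLastCentreTranslate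
import Summits.ResolutionOfSingularities.ResolutionOfSingularities.Theorems.FrobeniusLadderFInjectiveMacaulayficationFullLastCentreFibre
import HarnessLib

/-!
# `T_canon_door.lean` v7-lite — RE-BASED ON THE LANDED KERNEL FILES (K10 defs/K10/K10b/K10c): the CHAIN-LEVEL typed MC-8ᶜ of record with the budget ONLY AT x₀, the one-step form and its status, and the RECORD of the refuted cut (LC)
# (crux `FInjectiveMacaulayfication` stmt-ResolutionOfSingularities-15315, chain w45a; res-L1-w45a-plan-1 RULING R25.31 (4) + successor order list l.39120 (2);
# seat res-L1-w45a-lead-1 g16; «v3» = the desk's numbering — first typed edition of the one-centre door, after the (Sᶜ-A-i)/(ii) pair (v1, R25.28) and the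
# re-cut (LC)+(LP) in words (v2, `T-disc` rev 19 §0.24 (c)))

v7-lite (lead-1 g16, desk R26.49 RULE OF RECORD v2 = R2n-STRATUM): §3e `MaxDimCanon` (exceptional-stratum-first, maximal dimension, maximal Γ₂; OLDEST/slot ties untyped
⇒ set-valued; non-coordinate components invisible) and the EMPIRICAL v2 doors `V2ChainDoor`/`V2FibreDoor` beside the TRACK-E THEOREMS; the one-step v2 form is dead at birth
(bed 178, register row #16). «lite»: the affine-linear door §3d (K10k ✓p735834 `equiLinFibreChain_cap`) and the unit-triangular door §3f (K10m ✓p737817 + K10m-b) are typed in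
v7-full (`L/res-L1-w45a-lead-1/T_canon_door_v7_pending.lean`, validated rc 0 by concatenation) and will replace this file as soon as the farm serves the oleans of
`…FullLastCentreLinChange`/`…TriSubst` (unbuilt on the check farm since 17:38Z).
v6.5 (lead-1 g16, desk R26.40 (g2) / R26.42 (1)): §3c THE FIBRE DOOR `MC8cFibre Canon` — the chain-level conjecture at ALL points of the charts (every blow-up followed by
the passage to an arbitrary point of the exceptional fibre, K10i ✓p734629 `IsTranslate`); ★★★ `mc8cFibre_equiOmega : MC8cFibre EquiOmega` PROVED from K10j ⊙p735030
`equiFibreChain_cap` (fibre no-rise law `ordLE_of_equi_fibre` + slack inheritance `allSlackLE_translate`): EQUI-ω CHAINS ARE TAME AT EVERY POINT, not only at chart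
origins; `mc8cChain_of_mc8cFibre`; `FibreDoorOfRecord := MC8cFibre TopLocusIs` (open). K10h ✓p734128 `…FullLastCentreTame` imported (one-stage tameness).
v6.4 (lead-1 g16): ★★★ `mc8cChain_equiOmega : MC8cChain EquiOmega` PROVED from K10g ✓p733669 `equiChain_cap` — THE CHAIN-LEVEL CONJECTURE OF RECORD HOLDS FOR EVERY
ω-PERMISSIBLE RULE (`EquiOmega S Nor`: at the base point the residual order equals the generic residual order along Z — the (b′)/R1/R3 centres of the bake-off);
so within the letter universe the cap side of K4.5 is a theorem for equi-ω arms and what remains there is TERMINATION (register row #14).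
v6.3 (lead-1 g16): `IsMinNorDeg`/`DropBudget` now IMPORTED from `…FullLastCentreDefs2` (✓p732736); ★ `not_oneStepCoordProxy : ¬ OneStepCoordProxy` :=
res-L1-w45a-stub-1's ✓p732861 `LastCentreBed178.not_mc8cOneStep_dropBudget_coordCanonical` (the cc one-step form with DropBudget REFUTED IN THE KERNEL, bed 178, ρ′ = 9);
★★ `mc8cChain_pointRule : MC8cChain (fun _ Nor => Nor = univ)` PROVED from K10e ✓p732652 `pointChain_cap` — the chain-level conjecture of record HOLDS for the rule
«always blow up the point»; K10f ✓p732862 (`highOrderChain_cap`: high-order chains of any-dimensional centres are tame without canonicity) imported for the record.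
v6.2 (desk R26.21 (β)): the DROP-POINT BUDGET `DropBudget S′` («ord₀ Disc(S′) ≤ 8 + 2Σ_{E∋x′} d_E» — K4 in the Weierstrass letter, not implied by the toric `Budgeted`)
is an explicit hypothesis of `MC8cOneStep`/`MC8cAtCentre`/`MC8cChain` at the drop point (option (β); (α) `SBudgeted`/x-shifts reserved); §4's v3 doors unchanged (refuted record).
v6.1 (res-L1-w45a-lead-1 g16, 2026-08-29): K10c ✓p730259 `…FullLastCentreBudget.budgeted_chart` is imported and the `Budgeted S′` hypothesis is DROPPED from `Reachable.step`:
`budgeted_of_reachable` is now PROVED by transport from `Budgeted S₀` (the K4-survivor shadow of F-purity at x₀) — the chain-level conjecture `MC8cChain Canon` carries the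
F-content only at the initial stage, canonicity of the whole history, and nothing else. Status notes: `MC8cOneStep CoordCanonical` is now refuted IN THE KERNEL
(res-L1-w45a-stub-1 ✓p731555 `…FullLastCentreBed178Instance.not_mc8cOneStep_coordCanonical`); rule (b) does not terminate (desk R26.7), rule of record v2 pending the
bake-off (R26.9/R26.18) — `Canon` stays a parameter.
v6 (res-L1-w45a-lead-1 g16, 2026-08-29): §1/§2 are no longer local copies — the file IMPORTS the landed `Theorems/…FullLastCentreDefs` (✓p727906), `…FullLastCentreAxisOrder`
(K10 ✓p729098: `chartMap_X`, `disc_chart`, `rho_le_axisOrd`, `residual_transport`, `ordLE_iff`, `rho_le_rho_of_point`) and `…FullLastCentreResidual` (K10b ✓p729821: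
`exists_isResidual`, `not_isDropPoint_of_permissible_univ`), so every typed statement below is about the SAME constants as res-L1-w45a-stub-1's kernel negative
(`…FullLastCentreBedCInstance`); K10c `…FullLastCentreBudget` (⊙p730259: `budgeted_chart` — the budget scheme is transported exactly by a chart) makes the `Budgeted S′`
hypotheses carried in `Reachable` redundant given `Budgeted S₀`; they are kept (harmless) until K10c lands. Statements of §3–§4 are byte-identical to v5 modulo the namespace.
v5 (desk g26 R26.1 (B)(B3), 2026-08-29): the typed CONJECTURE OF RECORD is CHAIN-LEVEL — `MC8cChain Canon`: from an INITIAL stage (`Exc = ∅`, multiplicity 3 at x₀,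
`Budgeted`, `Canon S₀ univ`) along ANY chain of blow-ups at permissible `Canon` centres (`Reachable`, budgets carried), a drop point has `ρ ≤ 8` (`ChainDoorOfRecord :=
MC8cChain TopLocusIs` = the letter shadow of (Sᶜ₁) `T-disc` §0.24 (b)); the HISTORY-FREE one-step form `MC8cOneStep` stays as the named STRONG form with
`mc8cChain_of_oneStep` PROVED, and its status: `MC8cOneStep CoordCanonical` is REFUTED at letter level by the two `canonlast` ρ = 9 records of kit j332890 (res-L1-w45a-lead-1
g16 `comp-g16/canonlast_check.py`: every hypothesis incl. `Budgeted` by dominating monomials / an exact LP certificate holds, ρ′ = 9); `MC8cOneStep TopLocusIs` hangs on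
ONE geometric byte (is the last centre the top locus there? tri-2, R26.1 (B2)). New in v5: `exists_isResidual` (every nonzero `D` has a residual decomposition — proved),
`Initial`, `Reachable`, `budgeted_of_reachable`, `MC8cChain`, `mc8cChain_of_oneStep`, `ChainDoorOfRecord`.
v4 (R25.41 (iii), 2026-08-29): the cone-initial cut (LC) typed in v3 (`LastCentreConeBound` ⇒ `AxisOrdLE … 8`) was EVALUATED by res-L1-w45a-tri-2 g23 at the first
canonical SURFACE centre on record (bed c, stage 2, Π₂ = V(x″,t′,y₄″), direction t′; second engine res-L1-w45a-lead-1 g16 `comp-g16/bedc_door.py`) and FAILS there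
(ν = 2, minimal-normal-degree monomials t′²ỹ₂^k, k = 11..18 ⇒ axis order 11 > 8) while MC-8ᶜ HOLDS (ρ′ = 6, realised by 7t′³ỹ₃⁵ of normal degree ν + 1):
(LC) is REFUTED AS A DOOR at positive-dimensional centres (desk R25.41 (B)); the inequality `rho_le_axisOrd` stands but its cut is lossy. v4 therefore (a) adds the
EXACT one-step law as THEOREMS (`residual_transport`: the monomials of N′ are those of N re-graded, bijectively; `ordLE_iff`: `ρ′ ≤ m ⟺ ∃ e ∈ supp N,
(|e| − e_L) + (ndeg e − ν) ≤ m` — ALWAYS an equality), (b) keeps as the typed conjecture only `MC8cOneStep` (= MC-8ᶜ for one blow-up of a canonical centre;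
margin +2 at the instance) together with its EQUIVALENT centre-side form `MC8cAtCentre` (proved equivalent), and (c) keeps v3's doors `LastCentreConeBound`/`LC`/
`LP`/`DoorCoordProxy`/`DoorOfRecord` ONLY AS NAMED RECORD, labelled REFUTED-AS-DOOR (the kernel negative `not_doorCoordProxy` over `ZMod 11` is res-L1-w45a-stub-1's
helper file on the landed K10 definitions). Honest reading (desk): at positive-dimensional canonical centres NO simplification of MC-8ᶜ is in hand; what canonicity must
supply is ONE monomial of `N` of `L`-chart weight `≤ 8 + ν` for every direction `L` that carries a drop point.

[OURS · L1 W4.5a] Crux workfile (`ledger crux write … Lines/T_canon_door.lean`); TYPED TARGETS (`def … : Prop`, no axiom, no sorry) + PROVED bookkeeping;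
replaces the role of NO printed item; NOT a statement of the manuscript; nothing of the crux is proved here; OURS counted 0. AI-written (AI review is weaker
than expert review).

## What is typed, honestly
THE UNIVERSE is the engines' universe, stated without truncation: a STAGE is a monic cubic `P = x³ + b₂x² + b₁x + b₀`, `bᵢ ∈ k[y₁,…,y₄]` (letters
`Fin 4` = the four non-Weierstrass chart coordinates at a chart origin `x_j`; `x` never a direction), together with the set `Exc ⊆ Fin 4` of EXCEPTIONAL
letters through `x_j` and their SIGNED DEFECTS `d : Fin 4 → ℤ` (`d_E = a_E − e_E`, `T-disc` §0.24 (a)). A CENTRE is a COORDINATE subspace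
`Z = V(x, y_n : n ∈ Nor)` (`Nor` = normal letters, `|Nor| = codim_W Z − 1`; point `|Nor| = 4`, curve 3, surface 2, threefold 1); PERMISSIBILITY = normal
flatness of multiplicity 3 = `bᵢ ∈ I_Z^i` (support condition). The BLOW-UP of `Z` in the `y_L`-chart (`L ∈ Nor`) is the monomial substitution
`σ_L : y_n ↦ y_n·y_L (n ∈ Nor, n ≠ L)`, and the controlled transform is `P′ = x³ + b₂′x² + b₁′x + b₀′` with `σ_L(bᵢ) = y_L^i·bᵢ′`; the new stage has
`Exc′ = Exc ∪ {L}` (slot `L` now names `E_Z`) and `d′_L = (|Nor| + 1 − 4) + Σ_{n ∈ Exc ∩ Nor} d_n`. A DROP POINT at the chart origin `x′`: `b₂′(0) ≠ 0`,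
`b₁′(0) = 0`, `ord b₀′ ≥ 2` (multiplicity has dropped to 2; `T-disc` §0.1: at such a point `Disc_x(P′) = −4a″·Res²` with `Res` a unit, so every order below may be
read on `D′ := Disc_x(P′)` instead of the Weierstrass datum `a″` — the MASTER FORMULA; this file works with `D′` throughout, which is EXACT).
RESIDUALS: `D = y^α·N` with `α` supported on `Exc` and `N` prime to every exceptional letter (`IsResidual`); `ρ := ord₀ N` («ord N», the letter ρ of the sweeps).
THE CONE-INITIAL PART OF THE RESIDUAL READ AT THE DROP POINT: for `e ∈ supp N` of MINIMAL normal degree `ν = Σ_{n∈Nor} e_n`, the monomial `y^e` of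
`in_Z(N)` lands in the `y_L`-chart of `E_Z ≅ ℙ(N_Z)`-bundle with order `|e| − e_L` at `x′`; `AxisOrdLE Nor L N m` says some such monomial has `|e| − e_L ≤ m` —
for `ν = 0` this is `ord_x(N|_Z) ≤ m`, for `ν ≥ 1` it contains the pure-direction coefficient `[L^ν]N` of `T-disc` §0.24 (c) and is implied by `ord_x([L^ν]N) ≤ m`.

## Contents
* §1 definitions (`disc`, `tau`/`chartMap` = `σ_L` as the ring endomorphism induced by the additive exponent map `e ↦ e + (Σ_{Nor∖L} e_n)·ε_L`,
  `Stage`, `Permissible`, `IsChart`, `IsDropPoint`, `IsResidual`, `OrdLE`, `AxisOrdLE`, `Budgeted`, `CoordCanonical`, `TopLocusIs`).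
* §2 ★ PROVED (kernel, std axioms): `chartMap_X` (σ_L is the blow-up chart map), `disc_chart` (`σ_L(Disc P) = y_L⁶·Disc P′`), and
  ★★ `rho_le_axisOrd` — THE [ELEM] REDUCTION OF R25.31 (4) WITHOUT GENERICITY: at the `y_L`-chart origin of the blow-up of ANY permissible coordinate
  centre (no canonicity, no budget, no drop condition needed), `ρ′ ≤ min {|e| − e_L : e ∈ supp N, Σ_{Nor} e = ν}`; in particular `ρ′ ≤ ord_x(N|_Z)` when
  `ν = 0`, `ρ′ ≤ ord_x([L^ν]N)` when `ν ≥ 1`, and (point centre) the LAW `ρ′ ≤ ρ` (`rho_le_rho_of_point`). Answer to the desk's question to tri-2 («is the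
  reduction exact or an inequality with hidden genericity?»): an INEQUALITY, exact bookkeeping, no genericity, valid letter by letter over any field.
* §3 TYPED TARGETS (conjectures of record, `def … : Prop`): `LastCentreConeBound` = the unified one-centre door «at a CANONICAL permissible centre whose
  `y_L`-chart origin is a drop point, `AxisOrdLE Nor L N 8`», under the F-content `Budgeted` (the toric budget scheme
  `v_w(P) ≤ Σ_i w_i + Σ_{n∈Exc} d_n·w_n` for every weight `w`, at the stage AND at the drop point); `LC` = its `dim Z ≥ 1` case, `LP` = its point case
  (then `AxisOrdLE univ L N 8` reads: the drop point `x′ ∈ E ≅ ℙ³` is a point of multiplicity `≤ 8` of the projectivised tangent cone `{in_x(N) = 0}`);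
  `MC8c_oneStep` = the consequence `ρ′ ≤ 8`, and ★ `mc8c_oneStep_of_lastCentreConeBound : LastCentreConeBound C → MC8c_oneStep C` PROVED from §2 for
  every canonicity predicate `C`. Two canonicity predicates are offered: `CoordCanonical` (the COORDINATE proxy of the sweeps — necessary, not sufficient)
  and `TopLocusIs` (ideal-theoretic: `Sing₃(X) = Z` near `x`, via the Jacobian-type ideal `J₃` of the cubic in `k[x,y]` localised at the origin —
  the REGULAR-top-locus case of the rule of record; `-- TODO(general form)`: the singular-`T₀` recursion of R25.26 (b) is not typed here).
## Scope limits, stated (not hidden)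
(i) chart ORIGINS and COORDINATE centres only (the letter-chain universe; a canonical centre that is not a coordinate subspace in the running letters —
e.g. tri-2's plane `U` on bed a — is outside); (ii) polynomial data (an honest truncation of the formal germ: every quantity used is determined by a finite jet);
(iii) the F-content is the toric budget scheme only (K4 `le_sum_weights_of_survivor` transported along the chain; the section square/cube budgets of K9 are NOT
assumed — adding them can only weaken the targets); (iv) «Case-B rank-one» is not imposed on the drop point (every multiplicity-drop chart origin is
covered — a stronger target); (v) evidence for `LastCentreConeBound CoordCanonical` with ALL earlier centres coordinate-canonical: kit j332197 (2) = 1 442 drop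
points, exact letter ρ ≤ 8 (lead-1 g16 recheck c1db42a88c764e91); the ONE-CENTRE reading (history arbitrary) is what manifest M-g16-1's `canonlast` column tests.
-/

-- single-problem summit: the doubled namespace component is forced
set_option linter.dupNamespace false

noncomputable section

open MvPolynomial Finsupp
open Summit.ResolutionOfSingularities.ResolutionOfSingularities.Theorems.FInjectiveMacaulayfication.LastCentreDefs
open Summit.ResolutionOfSingularities.ResolutionOfSingularities.Theorems.FInjectiveMacaulayfication.LastCentreAxisOrder
open Summit.ResolutionOfSingularities.ResolutionOfSingularities.Theorems.FInjectiveMacaulayfication.LastCentreResidual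
open Summit.ResolutionOfSingularities.ResolutionOfSingularities.Theorems.FInjectiveMacaulayfication.LastCentreBudget
open Summit.ResolutionOfSingularities.ResolutionOfSingularities.Theorems.FInjectiveMacaulayfication.LastCentrePointChain
open Summit.ResolutionOfSingularities.ResolutionOfSingularities.Theorems.FInjectiveMacaulayfication.LastCentreSlack
open Summit.ResolutionOfSingularities.ResolutionOfSingularities.Theorems.FInjectiveMacaulayfication.LastCentreEquiChain
open Summit.ResolutionOfSingularities.ResolutionOfSingularities.Theorems.FInjectiveMacaulayfication.LastCentreTame
open Summit.ResolutionOfSingularities.ResolutionOfSingularities.Theorems.FInjectiveMacaulayfication.LastCentreTranslate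
open Summit.ResolutionOfSingularities.ResolutionOfSingularities.Theorems.FInjectiveMacaulayfication.LastCentreFibre

namespace Summit.ResolutionOfSingularities.ResolutionOfSingularities.Cruxes.FInjectiveMacaulayfication.TCanonDoor

variable {k : Type} [Field k]

/-! ## §1–§2: see the imported kernel files (definitions `Stage`, `chartMap`, `IsChart`, `IsDropPoint`, `IsResidual`, `OrdLE`, `AxisOrdLE`, `Budgeted`,
`CoordCanonical`, `TopLocusIs`; theorems `disc_chart`, `rho_le_axisOrd`, `residual_transport`, `ordLE_iff`, `rho_le_rho_of_point`, `exists_isResidual`). -/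

/-! ## §3 The typed conjecture of record for ONE blow-up: MC-8ᶜ one step, drop-point side and centre side (equivalent by `ordLE_iff`) -/

/-- MC-8ᶜ, ONE-STEP FORM (the typed conjecture of record for one blow-up; parameterised by a canonicity predicate `Canon`): at a permissible COORDINATE centre
`Z ∋ x` which is canonical, on a budgeted stage, if the `y_L`-chart origin `x′` of `Bl_Z` is a drop point on a budgeted stage, then the residual order there is
`ρ′ ≤ 8` (no wild drop point for `p ≥ 11`). Untouched by the bed-c instance (there `ρ′ = 6`). [conjecture · OURS · L1 W4.5a · typed target, NOT proved] -/
def MC8cOneStep (Canon : ∀ {k : Type} [Field k], Stage k → Finset Letter → Prop) : Prop :=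
  ∀ (k : Type) [Field k] (S S' : Stage k) (Nor : Finset Letter) (L : Letter) (α α' : Expo) (N N' : YPoly k),
    Nor.Nonempty → L ∈ Nor → Permissible S Nor → Canon S Nor → Budgeted S →
      IsChart S Nor L S' → IsDropPoint S' → DropBudget S' → Budgeted S' → IsResidual S.Exc S.D α N → IsResidual S'.Exc S'.D α' N' →
        OrdLE N' 8

/-- THE SAME CONJECTURE READ AT THE CENTRE (exact law): under the same hypotheses, SOME monomial `y^e` of the residual `N` at `x` has `L`-chart weight
`(|e| − e_L) + (ndeg_Z e − ν) ≤ 8`, `ν` the minimal normal degree. This is what canonicity must supply. [conjecture · OURS · L1 W4.5a · typed target, NOT proved] -/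
def MC8cAtCentre (Canon : ∀ {k : Type} [Field k], Stage k → Finset Letter → Prop) : Prop :=
  ∀ (k : Type) [Field k] (S S' : Stage k) (Nor : Finset Letter) (L : Letter) (α α' : Expo) (N N' : YPoly k) (ν : ℕ),
    Nor.Nonempty → L ∈ Nor → Permissible S Nor → Canon S Nor → Budgeted S →
      IsChart S Nor L S' → IsDropPoint S' → DropBudget S' → Budgeted S' → IsResidual S.Exc S.D α N → IsResidual S'.Exc S'.D α' N' →
        IsMinNorDeg Nor N ν → ∃ e ∈ N.support, tdeg e + norDeg Nor e ≤ 8 + e L + ν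

/-- ★ The two forms are EQUIVALENT (by the exact one-step law `ordLE_iff`; the centre-side form needs `ν`, which exists as soon as `N ≠ 0`, and `N ≠ 0` is forced by
`IsResidual` at `x′` whenever `Exc′ ∋ L` is nonempty — we simply carry `ν` as data). [OURS · L1 W4.5a · proved] -/
theorem mc8cOneStep_iff_atCentre (Canon : ∀ {k : Type} [Field k], Stage k → Finset Letter → Prop) :
    MC8cOneStep Canon ↔ MC8cAtCentre Canon := by
  constructor
  · intro h k _ S S' Nor L α α' N N' ν hne hL hperm hcan hbud hch hdrop hdb hbud' hres hres' hν
    exact (ordLE_iff hL hch hres hres' hν.1 hν.2 8).mp (h k S S' Nor L α α' N N' hne hL hperm hcan hbud hch hdrop hdb hbud' hres hres')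
  · intro h k _ S S' Nor L α α' N N' hne hL hperm hcan hbud hch hdrop hdb hbud' hres hres'
    classical
    -- ν exists: N′ ≠ 0 is not needed — if N = 0 then σN = 0, so y^B·N′ = 0, N′ = 0 and OrdLE N′ 8 needs a monomial; we get one from N via h when N ≠ 0,
    -- and when N = 0 the residual hypothesis at x′ (L ∈ Exc′ has a witness monomial of N′) gives N′ ≠ 0, whence N ≠ 0 by the support equation.
    have hL' : L ∈ S'.Exc := by rw [hch.2.2.2.1]; exact Finset.mem_insert_self _ _
    obtain ⟨e₀, he₀, -⟩ := hres'.2.2 L hL'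
    -- a monomial of N from a monomial of N′ (support equation, as in `residual_transport`'s first half — re-derived inline)
    have hN0 : N.support.Nonempty := by
      by_contra hemp
      rw [Finset.not_nonempty_iff_eq_empty, MvPolynomial.support_eq_empty] at hemp
      have hEQ : chartMap Nor L S.D = X L ^ 6 * S'.D := disc_chart hch
      rw [hres.1, hemp, mul_zero, map_zero, hres'.1, ← mul_assoc, X_pow_eq_monomial, monomial_mul, one_mul] at hEQ
      have := congrArg (coeff (Finsupp.single L 6 + α' + e₀)) hEQ
      rw [coeff_zero, coeff_add_monomial_mul] at this
      exact (MvPolynomial.mem_support_iff.mp he₀) this.symm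
    obtain ⟨e₁, he₁, hmin⟩ := Finset.exists_min_image N.support (norDeg Nor) hN0
    have hν : IsMinNorDeg Nor N (norDeg Nor e₁) := ⟨⟨e₁, he₁, rfl⟩, fun e he => hmin e he⟩
    exact (ordLE_iff hL hch hres hres' hν.1 hν.2 8).mpr (h k S S' Nor L α α' N N' _ hne hL hperm hcan hbud hch hdrop hdb hbud' hres hres' hν)

/-! ## §3b THE CHAIN-LEVEL CONJECTURE OF RECORD (desk R26.1 (B3)): `MC8cChain` -/

/-- INITIAL STAGE (the FULL triple point x₀ of the T-side): no exceptional letters, multiplicity 3 at the origin, the toric budget scheme (K4-survivor shadow of F-purity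
at x₀), and x₀ canonical as a point centre (`Canon S₀ univ`: for `TopLocusIs`, x₀ isolated in `Sing₃`). [OURS · L1 W4.5a] -/
def Initial (Canon : ∀ {k : Type} [Field k], Stage k → Finset Letter → Prop) (S₀ : Stage k) : Prop :=
  S₀.Exc = ∅ ∧ Permissible S₀ Finset.univ ∧ Budgeted S₀ ∧ Canon S₀ Finset.univ

/-- `Reachable Canon S₀ S`: `S` is a chart origin of a chain of blow-ups starting at `S₀`, EVERY centre permissible and `Canon` (the WHOLE history canonical is the
hypothesis); NO budget hypothesis after x₀ — budgets are transported (K10c `budgeted_chart`, `budgeted_of_reachable`). [OURS · L1 W4.5a] -/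
inductive Reachable (Canon : ∀ {k : Type} [Field k], Stage k → Finset Letter → Prop) (S₀ : Stage k) : Stage k → Prop
  | refl : Reachable Canon S₀ S₀
  | step {S S' : Stage k} (Nor : Finset Letter) (L : Letter) :
      Reachable Canon S₀ S → Nor.Nonempty → L ∈ Nor → Permissible S Nor → Canon S Nor → IsChart S Nor L S' →
        Reachable Canon S₀ S'

/-- ★ Every reachable stage is budgeted — by TRANSPORT from x₀ (K10c `budgeted_chart`), not by hypothesis. [OURS · L1 W4.5a · proved] -/
theorem budgeted_of_reachable {Canon : ∀ {k : Type} [Field k], Stage k → Finset Letter → Prop} {S₀ S : Stage k}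
    (h0 : Initial Canon S₀) (h : Reachable Canon S₀ S) : Budgeted S := by
  induction h with
  | refl => exact h0.2.2.1
  | step Nor L _ _ hL _ _ hch ih => exact budgeted_chart hL hch ih

/-- ★★★ MC-8ᶜ, CHAIN LEVEL — THE TYPED CONJECTURE OF RECORD (desk R26.1 (B3); letter shadow of (Sᶜ₁), `T-disc` §0.24 (b)): from an initial stage, along every chain of
blow-ups at permissible `Canon` centres, every drop point has residual order `ρ ≤ 8`. Evidence (all on proxies weaker than `TopLocusIs`-histories): all-cc histories max 8
EXACTLY (1 442 chains, j332197 = j332890), recursion-proxy histories max 8 (M-g15-2), rule-canonical trees max 7 (Q23), tri-2ʼs bed-a canonical nodes ω ≤ 7.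
[conjecture · OURS · L1 W4.5a · typed target, NOT proved] -/
def MC8cChain (Canon : ∀ {k : Type} [Field k], Stage k → Finset Letter → Prop) : Prop :=
  ∀ (k : Type) [Field k] (S₀ S : Stage k) (α : Expo) (N : YPoly k),
    Initial Canon S₀ → Reachable Canon S₀ S → IsDropPoint S → DropBudget S → IsResidual S.Exc S.D α N → OrdLE N 8

/-- ★ THE HISTORY-FREE ONE-STEP FORM IMPLIES THE CHAIN FORM (`MC8cOneStep` is the STRONG form). [OURS · L1 W4.5a · proved] -/
theorem mc8cChain_of_oneStep (Canon : ∀ {k : Type} [Field k], Stage k → Finset Letter → Prop) (h : MC8cOneStep Canon) :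
    MC8cChain Canon := by
  intro k _ S₀ T α' N' h0 hreach hdrop hdb hres'
  cases hreach with
  | refl => exact absurd hdrop (not_isDropPoint_of_permissible_univ h0.2.1)
  | @step S _ Nor L hprev hne hL hperm hcan hch =>
    classical
    have hbud : Budgeted S := budgeted_of_reachable h0 hprev
    have hbud' : Budgeted T := budgeted_chart hL hch hbud
    -- a residual decomposition of the previous discriminant exists: S.D ≠ 0 because N′ ≠ 0
    have hL' : L ∈ T.Exc := by rw [hch.2.2.2.1]; exact Finset.mem_insert_self L S.Exc
    obtain ⟨e₀, he₀, -⟩ := hres'.2.2 L hL'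
    have hD : S.D ≠ 0 := by
      intro hz
      have hEQ : chartMap Nor L S.D = X L ^ 6 * T.D := disc_chart hch
      rw [hz, map_zero, hres'.1, ← mul_assoc, X_pow_eq_monomial, monomial_mul, one_mul] at hEQ
      have := congrArg (coeff (Finsupp.single L 6 + α' + e₀)) hEQ
      rw [coeff_zero, coeff_add_monomial_mul] at this
      exact (MvPolynomial.mem_support_iff.mp he₀) this.symm
    obtain ⟨α, N, hres⟩ := exists_isResidual S.Exc S.D hD
    exact h k S T Nor L α α' N N' hne hL hperm hcan hbud hch hdrop hdb hbud' hres hres'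

/-- THE TYPED CONJECTURE OF RECORD after v5: MC-8ᶜ along chains all of whose centres are the top locus (regular-top-locus case). [conjecture · OURS · L1 W4.5a] -/
def ChainDoorOfRecord : Prop := MC8cChain (fun S Nor => TopLocusIs S Nor)

/-- Status record (v5): the one-step form over the COORDINATE proxy is REFUTED at letter level (kit j332890 `canonlast` records sqpert s1 bed 178 / sqpert s2 bed 90,
ρ′ = 9 with every hypothesis certified — `comp-g16/canonlast_check.py`); named here so the refutation has a referent. [OURS · record only · refuted target] -/
def OneStepCoordProxy : Prop := MC8cOneStep (fun S Nor => CoordCanonical S Nor)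

/-- ★ THE cc ONE-STEP FORM IS REFUTED IN THE KERNEL (res-L1-w45a-stub-1 ✓p732861, bed 178 instance, ρ′ = 9 with every hypothesis incl. `DropBudget` certified).
[OURS · L1 W4.5a · proved negative] -/
theorem not_oneStepCoordProxy : ¬ OneStepCoordProxy :=
  Summit.ResolutionOfSingularities.ResolutionOfSingularities.Theorems.FInjectiveMacaulayfication.LastCentreBed178.not_mc8cOneStep_dropBudget_coordCanonical

/-- A `Reachable` chain all of whose centres are the point is a `PointReachable` chain (K10e). [plumbing] -/
theorem pointReachable_of_reachable {S₀ S : Stage k}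
    (h : Reachable (fun {k} [Field k] (_ : Stage k) (Nor : Finset Letter) => Nor = Finset.univ) S₀ S) : PointReachable S₀ S := by
  induction h with
  | refl => exact PointReachable.refl
  | step Nor L _ _ _ _ hcan hch ih => subst hcan; exact PointReachable.step L ih hch

/-- ★★ THE CHAIN-LEVEL CONJECTURE OF RECORD HOLDS FOR THE RULE «ALWAYS BLOW UP THE POINT» (the point-chain cap K7, typed: K10e `pointChain_cap`): from an initial stage,
along any chain of point blow-ups, every drop point satisfying the drop-point budget has `ρ ≤ 8`. [OURS · L1 W4.5a · proved] -/
theorem mc8cChain_pointRule : MC8cChain (fun {k} [Field k] (_ : Stage k) (Nor : Finset Letter) => Nor = Finset.univ) := by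
  intro k _ S₀ T α N h0 hreach hdrop hdb hres
  cases hreach with
  | refl => exact absurd hdrop (not_isDropPoint_of_permissible_univ h0.2.1)
  | @step S _ Nor L hprev hne hL hperm hcan hch =>
    subst hcan
    exact pointChain_cap h0.1 (pointReachable_of_reachable hprev) hch hres hdb

/-- ω-PERMISSIBILITY of the centre `Z = V(x, y_n : n ∈ Nor)` at the base point (the equi-ω condition of the bake-off arms R1/R3, desk R26.7 (B)/R26.36): for every residual
decomposition, the residual order at the point equals the generic residual order along `Z` — some monomial of `N` has total degree `≤` every normal degree
(`ρ(x) = ν_Z`). [OURS · L1 W4.5a] -/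
def EquiOmega {k : Type} [Field k] (S : Stage k) (Nor : Finset Letter) : Prop :=
  ∀ (α : Expo) (N : YPoly k), IsResidual S.Exc S.D α N → ∃ e ∈ N.support, ∀ e' ∈ N.support, tdeg e ≤ norDeg Nor e'

/-- Along a `Reachable EquiOmega` chain from an initial stage, every residual decomposition of every stage with nonzero discriminant is `EquiTame` (K10g).
[OURS · plumbing, proved] -/
theorem equiTame_of_reachable_equiOmega {S₀ S : Stage k} (h0 : Initial (fun {k} [Field k] S Nor => EquiOmega S Nor) S₀)
    (h : Reachable (fun {k} [Field k] S Nor => EquiOmega S Nor) S₀ S) (hD : S.D ≠ 0)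
    {α : Expo} {N : YPoly k} (hres : IsResidual S.Exc S.D α N) : EquiTame S α N := by
  classical
  induction h generalizing α N with
  | refl => right; intro n hn; rw [h0.1] at hn; exact absurd hn (Finset.notMem_empty n)
  | @step S S' Nor L hprev hne hL hperm hcan hch ih =>
    -- S.D ≠ 0
    have hD0 : S.D ≠ 0 := by
      intro hz
      have hEQ : chartMap Nor L S.D = X L ^ 6 * S'.D := disc_chart hch
      rw [hz, map_zero] at hEQ
      rcases mul_eq_zero.mp hEQ.symm with h | h
      · exact absurd h (pow_ne_zero _ (X_ne_zero L))
      · exact hD h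
    obtain ⟨α₀, N₀, hres₀⟩ := exists_isResidual S.Exc S.D hD0
    have hN0 : N₀.support.Nonempty := support_nonempty_of_chart hch hres₀ hres
    obtain ⟨e₁, he₁, hmin⟩ := Finset.exists_min_image N₀.support (norDeg Nor) hN0
    obtain ⟨e, he, hequi⟩ := hcan α₀ N₀ hres₀
    -- ν := norDeg e₁; the equi witness e has tdeg e ≤ ν, hence tdeg e = ν (tdeg ≥ norDeg ≥ ν)
    have hν : tdeg e = norDeg Nor e₁ := by
      have h1 := hequi e₁ he₁
      have h2 := hmin e he
      have h3 := norDeg_le_tdeg Nor e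
      omega
    exact equiTame_step hL hch hres₀ hres ⟨e₁, he₁, rfl⟩ (fun e' he' => hmin e' he') ⟨e, he, hν⟩ (ih hD0 hres₀)

/-- ★★★ THE CHAIN-LEVEL CONJECTURE OF RECORD HOLDS FOR EVERY ω-PERMISSIBLE RULE (K10g `equiChain_cap`, typed): from an initial stage, along any chain of blow-ups at
permissible centres that are ω-permissible at their base points, every drop point with the drop-point budget has `ρ ≤ 8`. [OURS · L1 W4.5a · proved] -/
theorem mc8cChain_equiOmega : MC8cChain (fun {k} [Field k] S Nor => EquiOmega S Nor) := by
  intro k _ S₀ T α N h0 hreach hdrop hdb hres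
  classical
  cases hreach with
  | refl => exact absurd hdrop (not_isDropPoint_of_permissible_univ h0.2.1)
  | @step S _ Nor L hprev hne hL hperm hcan hch =>
    have hL' : L ∈ T.Exc := by rw [hch.2.2.2.1]; exact Finset.mem_insert_self _ _
    obtain ⟨e₀, he₀, -⟩ := hres.2.2 L hL'
    have hTD : T.D ≠ 0 := by
      intro hz
      have h1 : T.D = monomial α 1 * N := hres.1
      rw [hz] at h1
      have := congrArg (coeff (α + e₀)) h1
      rw [coeff_zero, coeff_add_monomial_mul] at this
      exact (MvPolynomial.mem_support_iff.mp he₀) this.symm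
    have hSD : S.D ≠ 0 := by
      intro hz
      have hEQ : chartMap Nor L S.D = X L ^ 6 * T.D := disc_chart hch
      rw [hz, map_zero] at hEQ
      rcases mul_eq_zero.mp hEQ.symm with h | h
      · exact absurd h (pow_ne_zero _ (X_ne_zero L))
      · exact hTD h
    obtain ⟨α₀, N₀, hres₀⟩ := exists_isResidual S.Exc S.D hSD
    have hN0 : N₀.support.Nonempty := support_nonempty_of_chart hch hres₀ hres
    obtain ⟨e₁, he₁, hmin⟩ := Finset.exists_min_image N₀.support (norDeg Nor) hN0
    obtain ⟨e, he, hequi⟩ := hcan α₀ N₀ hres₀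
    have hν : tdeg e = norDeg Nor e₁ := by
      have h1 := hequi e₁ he₁
      have h2 := hmin e he
      have h3 := norDeg_le_tdeg Nor e
      omega
    exact ordLE_eight_of_equiTame_drop hL hch hres₀ hres ⟨e₁, he₁, rfl⟩ (fun e' he' => hmin e' he') ⟨e, he, hν⟩
      (equiTame_of_reachable_equiOmega h0 hprev hSD hres₀) hdb

/-- THE EQUI-ω DOOR: the typed conjecture of record instantiated at the ω-permissible rule — a THEOREM. [OURS · L1 W4.5a · proved] -/
def EquiOmegaDoor : Prop := MC8cChain (fun {k} [Field k] S Nor => EquiOmega S Nor)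

/-- The equi-ω door holds. [OURS · L1 W4.5a · proved] -/
theorem equiOmegaDoor_holds : EquiOmegaDoor := mc8cChain_equiOmega

/-! ## §3c THE FIBRE DOOR (desk R26.42 (1)): the same conjecture at ALL points of the charts — `MC8cFibre Canon`; a THEOREM for ω-permissible rules (K10i/K10j) -/

/-- `FibreReachable Canon S₀ S`: like `Reachable`, but EVERY blow-up is followed by the passage to an ARBITRARY point of the exceptional fibre over the base point
(K10i `IsTranslate` by `c` supported on the fibre letters `Nor ∖ {L}`; `c = 0` is the chart origin). The local history of every point of a resolution tree whose
centres are permissible `Canon` COORDINATE centres at the image points (letter universe, (g1)), started at the image point on `X₀`. [OURS · L1 W4.5a] -/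
inductive FibreReachable (Canon : ∀ {k : Type} [Field k], Stage k → Finset Letter → Prop) (S₀ : Stage k) : Stage k → Prop
  | refl : FibreReachable Canon S₀ S₀
  | step {S S' S'' : Stage k} (Nor : Finset Letter) (L : Letter) (c : Letter → k) :
      FibreReachable Canon S₀ S → Nor.Nonempty → L ∈ Nor → Permissible S Nor → Canon S Nor → IsChart S Nor L S' →
      IsTranslate S' c S'' → (∀ m, m ∉ Nor.erase L → c m = 0) → FibreReachable Canon S₀ S''

/-- Chart-origin chains are fibre chains (`c = 0`). [OURS · plumbing, proved] -/
theorem fibreReachable_of_reachable {Canon : ∀ {k : Type} [Field k], Stage k → Finset Letter → Prop} {S₀ S : Stage k}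
    (h : Reachable Canon S₀ S) : FibreReachable Canon S₀ S := by
  induction h with
  | refl => exact FibreReachable.refl
  | @step S S' Nor L _ hne hL hperm hcan hch ih =>
    exact FibreReachable.step Nor L (fun _ => 0) ih hne hL hperm hcan hch (isTranslate_zero S') (fun _ _ => rfl)

/-- ★ MC-8ᶜ AT ALL POINTS (the FIBRE DOOR, desk R26.42 (1)): from an initial stage, along any fibre chain of permissible `Canon` centres, every stage carrying the
drop-point budget has `ρ ≤ 8` for every residual decomposition. Implies `MC8cChain Canon` (`mc8cChain_of_mc8cFibre`). A CONJECTURE for `Canon = TopLocusIs` /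
the rule of record; a THEOREM for `Canon = EquiOmega` (`mc8cFibre_equiOmega`). [OURS · L1 W4.5a · conjecture (typed target)] -/
def MC8cFibre (Canon : ∀ {k : Type} [Field k], Stage k → Finset Letter → Prop) : Prop :=
  ∀ (k : Type) [Field k] (S₀ S : Stage k) (α : Expo) (N : YPoly k),
    Initial Canon S₀ → FibreReachable Canon S₀ S → IsDropPoint S → DropBudget S → IsResidual S.Exc S.D α N → OrdLE N 8

/-- The fibre door implies the chart-origin chain door. [OURS · plumbing, proved] -/
theorem mc8cChain_of_mc8cFibre (Canon : ∀ {k : Type} [Field k], Stage k → Finset Letter → Prop) (h : MC8cFibre Canon) : MC8cChain Canon :=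
  fun k _ S₀ S α N h0 hreach hdrop hdb hres => h k S₀ S α N h0 (fibreReachable_of_reachable hreach) hdrop hdb hres

/-- Along a `FibreReachable EquiOmega` chain every stage with `D ≠ 0` is `EquiFibreReachable` (K10j) from the initial stage: the ω-permissibility hypothesis of the
rule supplies the equi witness at every base point. [OURS · plumbing, proved] -/
theorem equiFibreReachable_of_fibreReachable {S₀ S : Stage k} (h : FibreReachable (fun {k} [Field k] S Nor => EquiOmega S Nor) S₀ S) (hD : S.D ≠ 0) :
    EquiFibreReachable S₀ S := by
  classical
  induction h with
  | refl => exact EquiFibreReachable.refl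
  | @step S S' S'' Nor L c hprev hne hL hperm hcan hch htr hc ih =>
    have hD' : S'.D ≠ 0 := fun hz => hD (by rw [htr.1, hz, map_zero])
    have hD0 : S.D ≠ 0 := by
      intro hz
      have hEQ : chartMap Nor L S.D = X L ^ 6 * S'.D := disc_chart hch
      rw [hz, map_zero] at hEQ
      rcases mul_eq_zero.mp hEQ.symm with h | h
      · exact absurd h (pow_ne_zero _ (X_ne_zero L))
      · exact hD' h
    obtain ⟨α₀, N₀, hres₀⟩ := exists_isResidual S.Exc S.D hD0
    obtain ⟨α', N', hres'⟩ := exists_isResidual S'.Exc S'.D hD'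
    have hN0 : N₀.support.Nonempty := support_nonempty_of_chart hch hres₀ hres'
    obtain ⟨e₁, he₁, hmin⟩ := Finset.exists_min_image N₀.support (norDeg Nor) hN0
    obtain ⟨e, he, hequi⟩ := hcan α₀ N₀ hres₀
    have hν : tdeg e = norDeg Nor e₁ := by
      have h1 := hequi e₁ he₁
      have h2 := hmin e he
      have h3 := norDeg_le_tdeg Nor e
      omega
    exact EquiFibreReachable.step Nor L α₀ N₀ (norDeg Nor e₁) c (ih hD0) hL hch hres₀ ⟨e₁, he₁, rfl⟩ (fun e' he' => hmin e' he')
      ⟨e, he, hν⟩ htr hc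

/-- ★★★ THE FIBRE DOOR HOLDS FOR EVERY ω-PERMISSIBLE RULE (K10j `equiFibreChain_cap`, typed): from an initial stage, along any chain of blow-ups at permissible
centres that are ω-permissible at their base points, EACH FOLLOWED BY THE PASSAGE TO AN ARBITRARY FIBRE POINT, every stage with the drop-point budget has `ρ ≤ 8`
— chart origin or not. Gap (g2) of R26.40 is closed for equi-ω rules. [OURS · L1 W4.5a · proved] -/
theorem mc8cFibre_equiOmega : MC8cFibre (fun {k} [Field k] S Nor => EquiOmega S Nor) := by
  intro k _ S₀ S α N h0 hreach _ hdb hres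
  have hD : S.D ≠ 0 := by
    rw [hres.1]
    refine mul_ne_zero (by rw [Ne, monomial_eq_zero]; exact one_ne_zero) fun hz => ?_
    obtain ⟨f, hf, -⟩ := hdb
    rw [hres.1, hz, mul_zero, MvPolynomial.support_zero] at hf
    exact Finset.notMem_empty f hf
  exact equiFibreChain_cap h0.1 (equiFibreReachable_of_fibreReachable hreach hD) hdb hres

/-- THE EQUI-ω FIBRE DOOR — a THEOREM. [OURS · L1 W4.5a · proved] -/
def EquiOmegaFibreDoor : Prop := MC8cFibre (fun {k} [Field k] S Nor => EquiOmega S Nor)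

/-- The equi-ω fibre door holds. [OURS · L1 W4.5a · proved] -/
theorem equiOmegaFibreDoor_holds : EquiOmegaFibreDoor := mc8cFibre_equiOmega

/-- THE FIBRE DOOR OF RECORD (rule of record's canonicity predicate `TopLocusIs`; OPEN — rule (b) is not ω-permissible). [OURS · L1 W4.5a · conjecture] -/
def FibreDoorOfRecord : Prop := MC8cFibre (fun S Nor => TopLocusIs S Nor)

/-! ## §3e THE RULE OF RECORD v2 (desk R26.49: R2n-STRATUM, set-valued at ties) AS A CANONICITY PREDICATE — `MaxDimCanon`; its doors are EMPIRICAL conjectures, beside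
the EquiOmega THEOREMS (TRACK E). The one-step form `MC8cOneStep MaxDimCanon` is DEAD AT BIRTH (register row #16, BED-178 AXES: every age convention picks the chain's
own centre at bed 178, ρ′ = 9 — evidence level; no kernel negative filed for this predicate); only the chain-level forms are conjectured. -/

/-- `Γ₂` of a candidate coordinate centre `Z = V(x, y_Nor)`: the exceptional exponent mass `Σ_{n ∈ Nor ∩ Exc} α_n` on its defining letters (the R2n tie-breaker).
[OURS · L1 W4.5a · definition] -/
def gammaTwo (Exc : Finset Letter) (α : Expo) (Nor : Finset Letter) : ℕ := ∑ n ∈ Nor ∩ Exc, α n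

/-- The (M)-branch candidates of R2n-STRATUM: EXCEPTIONAL STRATA `V(x, y_Nor)`, `Nor ⊆ Exc` non-empty, inside the multiplicity-3 locus. [OURS · L1 W4.5a · definition] -/
def ExcStratumCand (S : Stage k) (Nor : Finset Letter) : Prop := Nor.Nonempty ∧ Nor ⊆ S.Exc ∧ Permissible S Nor

/-- The general candidates: permissible coordinate centres through the point. [OURS · L1 W4.5a · definition] -/
def CoordCand (S : Stage k) (Nor : Finset Letter) : Prop := Nor.Nonempty ∧ Permissible S Nor

/-- ★ THE RULE OF RECORD v2 «R2n-STRATUM» AS FAR AS TYPABLE IN THE LETTER UNIVERSE (desk R26.35/R26.49): (M) if some exceptional stratum lies in `Sing₃`, the centre is an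
exceptional stratum of MAXIMAL DIMENSION with MAXIMAL `Γ₂` among those; ELSE a permissible coordinate centre of MAXIMAL DIMENSION (a maximal-dimensional COORDINATE
component of `Sing₃` — never an intersection) with maximal `Γ₂` among those. NOT TYPED (the predicate is SET-VALUED there, exactly as the rule of record is at slot
ties): the OLDEST tie-breaker (a `Stage` carries no ages) and the slot convention; and NON-COORDINATE components of `Sing₃` are invisible to the letter universe (an
affine-linear one is reached by K10k `IsLinChange` first; a non-linear one — bed bʼs cubic F-Q — is outside the model). HONESTY WORDING (R26.36 (C)): a
maximal-dimensional-component rule, Hironaka-permissible, exceptional-stratum-first, NOT ω-maximal (ρ may rise along it); its termination and its cap are EMPIRICAL.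
READING CHOICE (flagged): the (M)-branch here admits every exceptional stratum inside `Sing₃` (component or not), as in the «divide out the exceptional factor» move; if
the rule of record restricts (M) to exceptional strata that are COMPONENTS of `Sing₃`, intersect `ExcStratumCand` with inclusion-maximality among `CoordCand` — the doors
below only get weaker hypotheses, set-valuedness is unaffected. [OURS · L1 W4.5a · definition] -/
def MaxDimCanon (S : Stage k) (Nor : Finset Letter) : Prop :=
  (ExcStratumCand S Nor ∧ (∀ Nor', ExcStratumCand S Nor' → Nor.card ≤ Nor'.card) ∧
      ∀ (α : Expo) (N : YPoly k), IsResidual S.Exc S.D α N →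
        ∀ Nor', ExcStratumCand S Nor' → Nor'.card = Nor.card → gammaTwo S.Exc α Nor' ≤ gammaTwo S.Exc α Nor) ∨
  ((∀ Nor', ¬ ExcStratumCand S Nor') ∧ CoordCand S Nor ∧ (∀ Nor', CoordCand S Nor' → Nor.card ≤ Nor'.card) ∧
      ∀ (α : Expo) (N : YPoly k), IsResidual S.Exc S.D α N →
        ∀ Nor', CoordCand S Nor' → Nor'.card = Nor.card → gammaTwo S.Exc α Nor' ≤ gammaTwo S.Exc α Nor)

/-- A v2-canonical centre is permissible (both branches). [OURS · plumbing, proved] -/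
theorem permissible_of_maxDimCanon {S : Stage k} {Nor : Finset Letter} (h : MaxDimCanon S Nor) : Permissible S Nor := by
  rcases h with ⟨⟨-, -, hp⟩, -, -⟩ | ⟨-, ⟨-, hp⟩, -, -⟩
  · exact hp
  · exact hp

/-- THE v2 CHAIN DOOR `MC8cChain MaxDimCanon` — EMPIRICAL CONJECTURE [v2] (0 HITS: 7 geometric beds × 2 roots × 2 slots, 330/331 letter beds; geometric ord N ≤ 6;
letter margin 0 — desk R26.49). [OURS · L1 W4.5a · conjecture (typed target, empirical)] -/
def V2ChainDoor : Prop := MC8cChain (fun S Nor => MaxDimCanon S Nor)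

/-- THE v2 FIBRE DOOR `MC8cFibre MaxDimCanon` — EMPIRICAL CONJECTURE [v2]. [OURS · L1 W4.5a · conjecture (typed target, empirical)] -/
def V2FibreDoor : Prop := MC8cFibre (fun S Nor => MaxDimCanon S Nor)

/-- The v2 doors are nested: fibre ⇒ chain. (The affine-linear / unit-triangular v2 doors are typed in v7-full, pending the farm build of K10k/K10m.)
[OURS · plumbing, proved] -/
theorem v2Doors_nested : V2FibreDoor → V2ChainDoor := mc8cChain_of_mc8cFibre _

/-! ## §4 RECORD OF THE REFUTED CUT (v3's doors; REFUTED AS DOORS at positive-dimensional centres by bed c / Π₂, desk R25.41 (B); kept as names only) -/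

/-- [REFUTED AS A DOOR, R25.41 (B): false at bed cʼs canonical surface centre Π₂ for `Canon = CoordCanonical` (two engines), and for `Canon = TopLocusIs` modulo
the J₃-cofactors; the kernel negative is res-L1-w45a-stub-1's helper.] v3's one-centre door: canonical permissible centre + budgets + drop point ⇒
`AxisOrdLE Nor L N 8` (cone-initial cut). Kept as a NAME for the negative and for the record; do not cite as a conjecture. [OURS · L1 W4.5a · refuted target] -/
def LastCentreConeBound (Canon : ∀ {k : Type} [Field k], Stage k → Finset Letter → Prop) : Prop :=
  ∀ (k : Type) [Field k] (S S' : Stage k) (Nor : Finset Letter) (L : Letter) (α : Expo) (N : YPoly k),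
    Nor.Nonempty → L ∈ Nor → Permissible S Nor → Canon S Nor → Budgeted S →
      IsChart S Nor L S' → IsDropPoint S' → Budgeted S' → IsResidual S.Exc S.D α N →
        AxisOrdLE Nor L N 8

/-- [REFUTED AS A DOOR at `dim Z ≥ 1`, R25.41 (B)] (LC) = the positive-dimensional case of `LastCentreConeBound`. [OURS · L1 W4.5a · refuted target] -/
def LC (Canon : ∀ {k : Type} [Field k], Stage k → Finset Letter → Prop) : Prop :=
  ∀ (k : Type) [Field k] (S S' : Stage k) (Nor : Finset Letter) (L : Letter) (α : Expo) (N : YPoly k),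
    Nor.Nonempty → Nor ≠ Finset.univ → L ∈ Nor → Permissible S Nor → Canon S Nor → Budgeted S →
      IsChart S Nor L S' → IsDropPoint S' → Budgeted S' → IsResidual S.Exc S.D α N →
        AxisOrdLE Nor L N 8

/-- [UNTESTED; SAME LOSSY CUT — not a conjecture of record] (LP) = the point-centre case of `LastCentreConeBound` (`x′ ∈ E ≅ ℙ³` a point of multiplicity `≤ 8` of
`{in_x N = 0}`); by `ordLE_iff` the exact point-step law is `ρ′ = min_e [2|e| − e_L − ρ]`, so the cut can be lossy here too. [OURS · L1 W4.5a · record only] -/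
def LP (Canon : ∀ {k : Type} [Field k], Stage k → Finset Letter → Prop) : Prop :=
  ∀ (k : Type) [Field k] (S S' : Stage k) (L : Letter) (α : Expo) (N : YPoly k),
    Permissible S Finset.univ → Canon S Finset.univ → Budgeted S →
      IsChart S Finset.univ L S' → IsDropPoint S' → Budgeted S' → IsResidual S.Exc S.D α N →
        AxisOrdLE Finset.univ L N 8

/-- The record door splits into (LC) and (LP). [OURS · plumbing, proved] -/
theorem lastCentreConeBound_iff (Canon : ∀ {k : Type} [Field k], Stage k → Finset Letter → Prop) :
    LastCentreConeBound Canon ↔ LC Canon ∧ LP Canon := by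
  constructor
  · intro h
    exact ⟨fun k _ S S' Nor L α N hne _ hL => h k S S' Nor L α N hne hL,
      fun k _ S S' L α N => h k S S' Finset.univ L α N Finset.univ_nonempty (Finset.mem_univ L)⟩
  · rintro ⟨hC, hP⟩ k _ S S' Nor L α N hne hL hperm hcan hbud hch hdrop hbud' hres
    by_cases hNor : Nor = Finset.univ
    · subst hNor; exact hP k S S' L α N hperm hcan hbud hch hdrop hbud' hres
    · exact hC k S S' Nor L α N hne hNor hL hperm hcan hbud hch hdrop hbud' hres

/-- The refuted cut IMPLIES the one-step MC-8ᶜ (true implication with a false antecedent for the proxies on record — kept to document that (LC) was a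
SUFFICIENT cut, by `rho_le_axisOrd`). [OURS · L1 W4.5a · proved] -/
theorem mc8cOneStep_of_lastCentreConeBound (Canon : ∀ {k : Type} [Field k], Stage k → Finset Letter → Prop)
    (h : LastCentreConeBound Canon) : MC8cOneStep Canon := by
  intro k _ S S' Nor L α α' N N' hne hL hperm hcan hbud hch hdrop _ hbud' hres hres'
  exact rho_le_axisOrd hL hch hres hres' (h k S S' Nor L α N hne hL hperm hcan hbud hch hdrop hbud' hres)

/-- [REFUTED AS A DOOR modulo the `TopLocusIs` cofactors, R25.41 (B)] v3's door of record. [OURS · record only] -/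
def DoorOfRecordV3 : Prop := LastCentreConeBound (fun S Nor => TopLocusIs S Nor)

/-- [REFUTED, R25.41 (B): bed c / Π₂, engines tri-2 g23 + lead-1 g16; kernel negative = res-L1-w45a-stub-1's helper over `ZMod 11`] v3's coordinate-proxy door.
[OURS · record only] -/
def DoorCoordProxy : Prop := LastCentreConeBound (fun S Nor => CoordCanonical S Nor)

/-- The one-step (history-free, STRONG) form under ideal-theoretic canonicity; v5 status: NOT the conjecture of record (that is `ChainDoorOfRecord`); its fate hangs
on R26.1 (B2) (is `TopLocusIs` true at the two `canonlast` ρ = 9 centres?). [conjecture · OURS · L1 W4.5a · strong form] -/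
def OneStepDoorOfRecord : Prop := MC8cOneStep (fun S Nor => TopLocusIs S Nor)

end Summit.ResolutionOfSingularities.ResolutionOfSingularities.Cruxes.FInjectiveMacaulayfication.TCanonDoor

end
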